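import Literature.AlgebraicGeometry.HodgeTheory.WeightedPencilMonodromyLocalisation
import Literature.AlgebraicGeometry.HodgeTheory.PhamBrieskornLocalisedMonodromyNotUnipotent
import Literature.AlgebraicGeometry.HodgeTheory.SymmetricA3NonCommutationOfCircleTransportMonomial
import Literature.AlgebraicGeometry.HodgeTheory.SymmetricA3PencilChart
import Literature.Geometry.ComplexAnalytic.SuspendedNodePencilShellSubmersion
import HarnessLib

/-!
# Around an `A₃` member of a monomial pencil, no rational transport is unipotent (H-A3NU from a normal-form chart)

Family `hodge`, layer `Literature/AlgebraicGeometry/HodgeTheory`; theorems only (no definition, no named fact). Written by the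
prover seat `hodge-nonav-20241-p1` (g19, cell `hodge-nonav`) as the leaf of the port B4c of the programme «A₃-TRACE» (memo
`HOME/memos/PROGRAMME-A3-TRACE-Bx-g16.md`; binder hN′ `stub_a3NonCommOdd` of crux K1-B `VeryGeneralSignCommutatorsInHg`,
`Summits/HodgeConjecture/HodgeConjecture/Theses/SignSymmetricPowers.lean`, stmt-HodgeConjecture-19716, registry v25k). It assembles

* brick 8 `WeightedPencilMonodromyLocalisation.exists_localisationPackage_of_chart` (the localisation package of the geometric
  monodromy of the pencil `f₁ + c·(a₀ xᵢ^d)` around a member with one isolated singular point, from a chart `Θ` in which the pencil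
  coordinate is `Σ_l (Θ y)_l^{a_l}`),
* prover-Bx's B4b `surjective_fderiv_pencil_suspendedRadius_of_shell` (the shell submersion for the weights `(2, …, 2, p)`, `p ≥ 3`),
  packaged here as the UNIFORM hypothesis of brick 8 (`shellSubmersion_uniform_of_suspendedNode`, `rmax = 1/p`, `δ = s₀^p/2`),
* prover-Bx's socket S1 `not_isNilpotent_sub_one_of_localisedRotation_fiberOver` (a monodromy homeomorphism localising to `g` with
  `g⁴ = id`, `g ∘ g =` the rotation of the last coordinate by `v ≠ 1` is not unipotent on `Hⁿ`),

with, for the weights `a = (2, …, 2, 4)` of the `A₃` point, the two algebraic facts about the inverse weighted rotation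
`g = R_{−2π} = (−z₀, …, −z_{m}, −i·z_{m+1})` delivered by brick 8: `g⁴ = id` and `g ∘ g = rotateFibre (−1)` (`rotation_pow_weight_eq_one`,
`inverseRotation_iter_four`, `inverseRotation_iter_two`).

* **`circleTransport_not_unipotent_of_A3chart`** — H-A3NU(`f₁`, `a₀ xᵢ^d`) in the exact shape consumed by 19716-p2's junction
  `symmetricA3NonCommutation_mono_of_forall_circleTransport_not_unipotent`: **there is `R₀ > 0` such that for every `0 < R < R₀`, every
  loop `C` of forms `f₁ + R e^{2πiθ}·(a₀ xᵢ^d)`, every `hU` and every rational transport `T` along `C` in the middle degree,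
  `T − 1` is NOT nilpotent** — GIVEN: `f₁` homogeneous of degree `d ≥ 1` on `ℙᵐ⁺²` with a unique singular point `[p]`, `pᵢ ≠ 0`,
  nearby members `f₁ + c'·(a₀ xᵢ^d)` (`0 < |c'| < ε₁`) nonsingular, and a `C^∞` chart `Θ` (with `C^∞` inverse) at the affine point of
  `[p]` with `Σ_l (Θ y)_l^{a_l} = −f₁(ins_i 1 y)`, `a = (2, …, 2, 4)`. The chart is prover-Bx's B4a (`SymmetricA3NormalFormChart`, from
  `IsSymmetricA3Datum`); the nonsingularity is the bifurcation clause at `a′ = 0`.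

* **`symmetricA3NonCommutation_of_A3chart`** — hN′ at the consumed instance MODULO THE CHART: for `IsSymmetricA3Datum f₁ g₀ g₂ j k a`,
  `IsSymmetricA3Bifurcation …`, odd `n`, `g₀ = c·xᵢ^d`, and a chart `Θ` at `0` (the affine point of `e_j` in the chart `x_j = 1`) with
  `Σ_l (Θ y)_l^{w_l} = −f₁(ins_j 1 y)`, `w = (2, …, 2, 4)`: `∃ εa' > 0, εa' ≤ εa ∧ SymmetricA3NonCommutation n d f₁ g₀ g₂ ψ εa'`
  (19716-p2's junction `symmetricA3NonCommutation_mono_of_forall_circleTransport_not_unipotent` applied to H-A3NU; the unique singular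
  point, `g₀(e_j) ≠ 0` and the nonsingular nearby members come from the datum and the bifurcation clause at `a′ = 0`).

* **`symmetricA3NonCommutation_mono_holds`** — hN′ UNCONDITIONALLY: the statement of the registered stub `stub_a3NonCommOdd` of crux K1-B
  (skeleton v25k) verbatim, the chart being prover-Bx's B4a `IsSymmetricA3Datum.exists_pencil_A3Chart`
  (`SymmetricA3PencilChart`, from `SymmetricA3NormalFormChart`: holomorphic splitting lemma with parameter + quartic power chart).

Everything is proved; no definitions, no named facts. HONEST SCOPE: this is the non-commutation of the two local monodromies at a
symmetric `A₃` point for odd fibre dimension and a monomial even direction; nothing here says HC or any rung is proved (K1-B remains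
conditional on the Cattani–Deligne–Kaplan input hCDK).

## References

* [ArnoldGuseinzadeVarchenko2012] V. I. Arnold, S. M. Gusein-Zade, A. N. Varchenko, Singularities of Differentiable Maps II (2012),
  Part I §1.1, §2.1, §2.3, §5.2 (boundary singularity `B₂`).
* [Milnor1968] J. Milnor, Singular Points of Complex Hypersurfaces, §9 Thm. 9.1, Lemma 9.4, Lemma 5.10.
* [VoisinHodgeII2003] C. Voisin, Hodge Theory and Complex Algebraic Geometry II (2003), §3.1.2, §3.2.1 Thm. 3.16.
-/

noncomputable section

open CategoryTheory AlgebraicGeometry MvPolynomial TopologicalSpace Set Topology Filter Complex Metric Function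
open scoped Manifold ContDiff Real unitInterval
open Literature.AlgebraicGeometry.Motives Literature.AlgebraicGeometry.Motives.UniversalHypersurface
open Literature.AlgebraicGeometry.HodgeTheory.UniversalHypersurface Literature.Geometry.ComplexAnalytic Literature.Geometry.Manifold
open Literature.AlgebraicTopology.SingularHomology Literature.NumberTheory.Transcendental

namespace Literature.AlgebraicGeometry.HodgeTheory

namespace WeightedPencil

/-! ### The uniform shell submersion for the weights `(2, …, 2, p)` -/

/-- **The shell submersion for the weights `(2, …, 2, p)` in the uniform shape of
`exists_localisationPackage_of_chart`**: for `p ≥ 3`, `rmax = 1/p`, and a shell `s₀² ≤ Σ|Θ y|² ≤ r₂²` with `0 < s₀ ≤ r₂ < 1/p`, the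
differential of `(φ, Σ|Θ ·|²)` is onto wherever `|φ| ≤ s₀^p/2` (prover-Bx's `surjective_fderiv_pencil_suspendedRadius_of_shell`;
`r₂ < 1`, `r₂^{p−2} < (1/p)^{p−2} ≤ 1/p < 2/p`). [cite: Milnor1968, Lemma 5.10] [cite: ArnoldGuseinzadeVarchenko2012, Part I §2.1] -/
theorem shellSubmersion_uniform_of_suspendedNode {m : ℕ} {a : Fin (m + 2) → ℕ} {p : ℕ}
    (h2 : ∀ i : Fin (m + 1), a i.castSucc = 2) (hp : a (Fin.last (m + 1)) = p) (hp3 : 3 ≤ p)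
    (Θ : OpenPartialHomeomorph (Fin (m + 2) → ℂ) (Fin (m + 2) → ℂ))
    (hΘ : ContDiffOn ℝ ∞ Θ Θ.source) (hΘs : ContDiffOn ℝ ∞ Θ.symm Θ.target)
    (φ : (Fin (m + 2) → ℂ) → ℂ) (hΘφ : ∀ x ∈ Θ.source, ∑ i, (Θ x) i ^ a i = φ x) :
    ∀ s₀ r₂ : ℝ, 0 < s₀ → s₀ ≤ r₂ → r₂ < 1 / p → ∃ δ : ℝ, 0 < δ ∧
      ∀ y ∈ Θ.source, s₀ ^ 2 ≤ ∑ l, ‖Θ y l‖ ^ 2 → ∑ l, ‖Θ y l‖ ^ 2 ≤ r₂ ^ 2 → ‖φ y‖ ≤ δ →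
        Function.Surjective (fderiv ℝ (fun y' : Fin (m + 2) → ℂ => ((φ y' : ℂ), (∑ l, ‖Θ y' l‖ ^ 2 : ℝ))) y) := by
  intro s₀ r₂ hs₀ hsr hr
  have hp0 : (0 : ℝ) < p := by exact_mod_cast (show 0 < p by omega)
  have hp1 : (1 : ℝ) / p ≤ 1 := by rw [div_le_one hp0]; exact_mod_cast (show 1 ≤ p by omega)
  have hr₂0 : 0 ≤ r₂ := hs₀.le.trans hsr
  have hr₂1 : r₂ < 1 := lt_of_lt_of_le hr hp1
  have hr₂' : r₂ ^ (p - 2) < 2 / p := by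
    have h1 : r₂ ^ (p - 2) < (1 / p) ^ (p - 2) := pow_lt_pow_left₀ hr hr₂0 (by omega)
    have h2 : ((1 : ℝ) / p) ^ (p - 2) ≤ ((1 : ℝ) / p) ^ 1 := pow_le_pow_of_le_one (by positivity) hp1 (by omega)
    have h3 : ((1 : ℝ) / p) ^ 1 < 2 / p := by rw [pow_one]; exact div_lt_div_of_pos_right (by norm_num) hp0
    linarith
  refine ⟨s₀ ^ p / 2, by positivity, fun y hy hlow hup hφ => ?_⟩
  have hφ' : ‖φ y‖ < s₀ ^ p := lt_of_le_of_lt hφ (by have := pow_pos hs₀ p; linarith)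
  exact surjective_fderiv_pencil_suspendedRadius_of_shell h2 hp hp3 Θ hΘ hΘs φ hΘφ hs₀ hsr hr₂1 hr₂' hy hlow hup hφ'

/-! ### The inverse weighted rotation at the weights `(2, …, 2, 4)` -/

section Rotation

variable {m : ℕ} {a : Fin (m + 2) → ℕ} (h2 : ∀ i : Fin (m + 1), a i.castSucc = 2) (h4 : a (Fin.last (m + 1)) = 4)
include h2 h4

/-- All the weights `(2, …, 2, 4)` are non-zero. [cite: Milnor1968, §9 Lemma 9.4] -/
theorem weight_ne_zero_of_A3 (l : Fin (m + 2)) : a l ≠ 0 := by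
  refine Fin.lastCases ?_ (fun j => ?_) l
  · rw [h4]; norm_num
  · rw [h2 j]; norm_num

/-- All the weights `(2, …, 2, 4)` are at least `2`. [cite: Milnor1968, §9 Lemma 9.4] -/
theorem two_le_weight_of_A3 (l : Fin (m + 2)) : 2 ≤ a l := by
  refine Fin.lastCases ?_ (fun j => ?_) l
  · rw [h4]; norm_num
  · rw [h2 j]

omit h2 h4 in
/-- `(e^{−2πi/a})^a = 1` for `a ≠ 0`. [cite: Milnor1968, §9 Lemma 9.4] -/
theorem rotation_pow_weight_eq_one {k : ℕ} (hk : k ≠ 0) :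
    Complex.exp ((((-(2 * π)) / k : ℝ) : ℂ) * Complex.I) ^ k = 1 := by
  rw [PhamBrieskorn.exp_div_mul_I_pow hk,
    show (((-(2 * π) : ℝ)) : ℂ) * Complex.I = ((-1 : ℤ) : ℂ) * (2 * π * Complex.I) by push_cast; ring]
  exact Complex.exp_int_mul_two_pi_mul_I (-1)

/-- **`g⁴ = id`** for the inverse weighted rotation `g = R_{−2π}` at the weights `(2, …, 2, 4)`.
[cite: Milnor1968, §9 Lemma 9.4 and p. 77] -/
theorem inverseRotation_iter_four (g : C(↥(PhamBrieskorn.fibre a), ↥(PhamBrieskorn.fibre a)))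
    (hg : ∀ z, ((g z : ↥(PhamBrieskorn.fibre a)) : Fin (m + 2) → ℂ) =
      fun l => Complex.exp ((((-(2 * π)) / a l : ℝ) : ℂ) * Complex.I) * (z : Fin (m + 2) → ℂ) l)
    (z : ↥(PhamBrieskorn.fibre a)) : g (g (g (g z))) = z := by
  apply Subtype.ext
  rw [hg, hg, hg, hg]
  funext l
  simp only
  have hE4 : Complex.exp ((((-(2 * π)) / a l : ℝ) : ℂ) * Complex.I) ^ 4 = 1 := by
    refine Fin.lastCases ?_ (fun j => ?_) l
    · rw [← h4]; exact rotation_pow_weight_eq_one (by rw [h4]; norm_num)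
    · rw [show (4 : ℕ) = 2 * 2 from rfl, pow_mul]
      have h := rotation_pow_weight_eq_one (k := a j.castSucc) (by rw [h2 j]; norm_num)
      rw [h2 j] at h ⊢
      rw [h, one_pow]
  calc Complex.exp ((((-(2 * π)) / a l : ℝ) : ℂ) * Complex.I) *
        (Complex.exp ((((-(2 * π)) / a l : ℝ) : ℂ) * Complex.I) *
          (Complex.exp ((((-(2 * π)) / a l : ℝ) : ℂ) * Complex.I) *
            (Complex.exp ((((-(2 * π)) / a l : ℝ) : ℂ) * Complex.I) * (z : Fin (m + 2) → ℂ) l)))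
      = Complex.exp ((((-(2 * π)) / a l : ℝ) : ℂ) * Complex.I) ^ 4 * (z : Fin (m + 2) → ℂ) l := by ring
    _ = (z : Fin (m + 2) → ℂ) l := by rw [hE4, one_mul]

/-- **`g ∘ g` is the rotation of the last coordinate by `−1`** for the inverse weighted rotation `g = R_{−2π}` at the weights
`(2, …, 2, 4)` (`(e^{−πi})² = 1` on the quadratic coordinates, `(e^{−πi/2})² = −1` on the quartic one).
[cite: Milnor1968, §9 Lemma 9.4 and p. 77] -/
theorem inverseRotation_iter_two (g : C(↥(PhamBrieskorn.fibre a), ↥(PhamBrieskorn.fibre a)))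
    (hg : ∀ z, ((g z : ↥(PhamBrieskorn.fibre a)) : Fin (m + 2) → ℂ) =
      fun l => Complex.exp ((((-(2 * π)) / a l : ℝ) : ℂ) * Complex.I) * (z : Fin (m + 2) → ℂ) l)
    (hv : (-1 : ℂ) ∈ PhamBrieskorn.Omega (a (Fin.last (m + 1)))) (z : ↥(PhamBrieskorn.fibre a)) :
    g (g z) = PhamBrieskorn.rotateFibre a (weight_ne_zero_of_A3 h2 h4) ⟨-1, hv⟩ z := by
  apply Subtype.ext
  rw [hg, hg, PhamBrieskorn.rotateFibre_apply_coe]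
  funext l
  simp only
  rw [← mul_assoc, ← pow_two]
  refine Fin.lastCases ?_ (fun j => ?_) l
  · rw [PhamBrieskorn.rotateFun_last, h4]
    congr 1
    rw [sq, ← Complex.exp_add,
      show (((-(2 * π)) / (4 : ℕ) : ℝ) : ℂ) * Complex.I + (((-(2 * π)) / (4 : ℕ) : ℝ) : ℂ) * Complex.I = -(π * Complex.I) by
        push_cast; ring,
      Complex.exp_neg, Complex.exp_pi_mul_I]
    norm_num
  · rw [PhamBrieskorn.rotateFun_castSucc]
    have h := rotation_pow_weight_eq_one (k := a j.castSucc) (by rw [h2 j]; norm_num)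
    rw [h2 j] at h ⊢
    rw [h, one_mul]

end Rotation

/-! ### H-A3NU from the chart -/

set_option maxHeartbeats 800000 in
/-- **H-A3NU from a normal-form chart at the `A₃` point** (see the module docstring): for `m + 1, d ≥ 1`, a form `f₁` of degree `d`
in `m + 3` variables whose unique singular point `[p]` has `pᵢ ≠ 0`, nearby members `f₁ + c'·(a₀ xᵢ^d)` (`0 < |c'| < ε₁`) nonsingular,
and a `C^∞` chart `Θ` (with `C^∞` inverse) at the affine point of `[p]` with `Σ_l (Θ y)_l^{a_l} = −f₁(ins_i 1 y)`, `a = (2, …, 2, 4)`: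
there is `R₀ > 0` such that along every loop of forms `f₁ + R e^{2πiθ}·(a₀ xᵢ^d)` with `0 < R < R₀` no rational transport in degree
`m + 1` has `T − 1` nilpotent. [cite: ArnoldGuseinzadeVarchenko2012, Part I §2.3 and §5.2] [cite: Milnor1968, §9 Thm. 9.1 and Lemma 9.4]
[cite: VoisinHodgeII2003, §3.2.1 Thm. 3.16] -/
theorem circleTransport_not_unipotent_of_A3chart {m d : ℕ} (hd : 1 ≤ d) {f₁ : MvPolynomial (Fin (m + 1 + 2)) ℂ}
    (hf₁ : f₁.IsHomogeneous d) {p : Fin (m + 1 + 2) → ℂ} (hp0 : p ≠ 0)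
    (hsing : ∀ z : Fin (m + 1 + 2) → ℂ, z ≠ 0 → (∀ l, eval z (pderiv l f₁) = 0) → ∃ t : ℂ, z = t • p)
    (i : Fin (m + 1 + 2)) (hpi : p i ≠ 0) {a₀ : ℂ} (ha₀ : a₀ ≠ 0) {ε₁ : ℝ} (hε₁ : 0 < ε₁)
    (hns₁ : ∀ c' : ℂ, c' ≠ 0 → ‖c'‖ < ε₁ →
      SmoothHypersurface.IsNonsingularForm ℂ (f₁ + c' • (a₀ • X i ^ d : MvPolynomial (Fin (m + 1 + 2)) ℂ)))
    {a : Fin (m + 2) → ℕ} (h2 : ∀ l : Fin (m + 1), a l.castSucc = 2) (h4 : a (Fin.last (m + 1)) = 4)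
    (Θ : OpenPartialHomeomorph (Fin (m + 2) → ℂ) (Fin (m + 2) → ℂ))
    (hy₀s : (fun l => p (i.succAbove l) / p i) ∈ Θ.source) (hΘ0 : Θ (fun l => p (i.succAbove l) / p i) = 0)
    (hΘ : ContDiffOn ℝ ∞ Θ Θ.source) (hΘs : ContDiffOn ℝ ∞ Θ.symm Θ.target)
    (hΘφ : ∀ y ∈ Θ.source, ∑ l, (Θ y l) ^ a l = -eval (Fin.insertNth i (1 : ℂ) y : Fin (m + 1 + 2) → ℂ) f₁) :
    ∃ R₀ : ℝ, 0 < R₀ ∧ ∀ (R : ℝ), 0 < R → R < R₀ →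
      ∀ (s₀ : ComplexPoints (base ℂ (m + 1) d)) (C : Path s₀ s₀),
        (∀ θ : unitInterval, pointForm ℂ (m + 1) d (C θ) =
          f₁ + ((R : ℂ) * Complex.exp (2 * Real.pi * Complex.I * ((θ : ℝ) : ℂ))) • (a₀ • X i ^ d)) →
        ∀ (hU : IsCohomologicallyLocallyTrivialOn (family ℂ (m + 1) d) Set.univ)
          (T : bettiCohomology (fiberOver (family ℂ (m + 1) d) s₀) (m + 1) ≃ₗ[ℚ]
            bettiCohomology (fiberOver (family ℂ (m + 1) d) s₀) (m + 1)),
          IsRatTransport (family ℂ (m + 1) d) (m + 1) hU (loopClassUniv (m + 1) d C) T → ¬ IsNilpotent (T.toLinearMap - 1) := by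
  have ha : ∀ l, a l ≠ 0 := weight_ne_zero_of_A3 h2 h4
  have h2' : ∀ l, 2 ≤ a l := two_le_weight_of_A3 h2 h4
  have hv : (-1 : ℂ) ∈ PhamBrieskorn.Omega (a (Fin.last (m + 1))) := by
    rw [PhamBrieskorn.mem_Omega, h4]; norm_num
  -- the uniform shell submersion (B4b) and the package (brick 8)
  have hsubU := shellSubmersion_uniform_of_suspendedNode h2 h4 (by norm_num) Θ hΘ hΘs
    (fun y => -eval (Fin.insertNth i (1 : ℂ) y : Fin (m + 1 + 2) → ℂ) f₁) hΘφ
  obtain ⟨ε₀, hε₀, -, hpkg⟩ := exists_localisationPackage_of_chart (Nat.succ_pos m) hd hf₁ hp0 hsing i hpi ha₀ hε₁ hns₁ a ha Θ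
    hy₀s hΘ0 hΘ hΘφ (by positivity : (0 : ℝ) < 1 / (4 : ℕ)) hsubU
  refine ⟨ε₀, hε₀, fun R hR hRε s₀ C hC hU T hT => ?_⟩
  -- the base point carries the form `f₁ + R·(a₀ xᵢ^d)`
  have hs₀ : pointForm ℂ (m + 1) d s₀ = f₁ + (R : ℂ) • (a₀ • X i ^ d) := by
    have h := hC 0
    rw [C.source] at h
    rw [h]
    simp
  obtain ⟨A', B', hA'o, hB'o, hA'B', η, ηA, e', g, hηB, hηA, hbij, hg, hconj, hTη⟩ := hpkg R hR hRε s₀ hs₀ C hC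
  exact not_isNilpotent_sub_one_of_localisedRotation_fiberOver hd hA'o hB'o hA'B' η hηB ηA hηA h2' e' (hbij ℂ ℂ (m + 1)) g
    hconj (inverseRotation_iter_four h2 h4 g hg) ⟨-1, hv⟩ (by norm_num) (inverseRotation_iter_two h2 h4 g hg hv) T
    (hTη hU (m + 1) T hT)

/-! ### hN′ modulo the chart -/

/-- **`SymmetricA3NonCommutation` at the consumed instance, modulo the normal-form chart at the `A₃` point** (see the module
docstring). [cite: ArnoldGuseinzadeVarchenko2012, Part I §5.2 and §2.3] [cite: VoisinHodgeII2003, §3.2.1 Thm. 3.16]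
[cite: Milnor1968, §9 Thm. 9.1 and Lemma 9.4] -/
theorem symmetricA3NonCommutation_of_A3chart {n d : ℕ} (hn : 1 ≤ n) (hd : 1 ≤ d) (hodd : Odd n)
    {f₁ g₀ g₂ : MvPolynomial (Fin (n + 2)) ℂ} {j k : Fin (n + 2)} {a : Fin (n + 2) → ℂˣ} {εa εb : ℝ} {ψ : ℂ → ℂ}
    (hg₀X : ∃ (i : Fin (n + 2)) (c : ℂ), g₀ = c • X i ^ d) (hf₁ : f₁.IsHomogeneous d) (hg₀ : g₀.IsHomogeneous d)
    (hg₂ : g₂.IsHomogeneous d) (hD : IsSymmetricA3Datum f₁ g₀ g₂ j k a) (hB : IsSymmetricA3Bifurcation f₁ g₀ g₂ j a εa εb ψ)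
    {w : Fin (n + 1) → ℕ} (h2 : ∀ l : Fin n, w l.castSucc = 2) (h4 : w (Fin.last n) = 4)
    (Θ : OpenPartialHomeomorph (Fin (n + 1) → ℂ) (Fin (n + 1) → ℂ))
    (h0s : (0 : Fin (n + 1) → ℂ) ∈ Θ.source) (hΘ0 : Θ 0 = 0)
    (hΘ : ContDiffOn ℝ ∞ Θ Θ.source) (hΘs : ContDiffOn ℝ ∞ Θ.symm Θ.target)
    (hΘφ : ∀ y ∈ Θ.source, ∑ l, (Θ y l) ^ w l = -eval (Fin.insertNth j (1 : ℂ) y : Fin (n + 2) → ℂ) f₁) :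
    ∃ εa' : ℝ, 0 < εa' ∧ εa' ≤ εa ∧ SymmetricA3NonCommutation n d f₁ g₀ g₂ ψ εa' := by
  obtain ⟨m, rfl⟩ : ∃ m, n = m + 1 := ⟨n - 1, by omega⟩
  obtain ⟨i, c, hg₀eq⟩ := hg₀X
  -- from the datum: the unique singular point `e_j`, and `g₀(e_j) ≠ 0`, so `i = j` and `c ≠ 0`
  have hsing := hD.2.2.1
  have hg₀e : eval (Pi.single j 1 : Fin (m + 1 + 2) → ℂ) g₀ ≠ 0 := hD.2.2.2.2.2.2.2.1
  have hev : eval (Pi.single j 1 : Fin (m + 1 + 2) → ℂ) g₀ = c * (Pi.single j (1 : ℂ) : Fin (m + 1 + 2) → ℂ) i ^ d := by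
    rw [hg₀eq]; simp
  obtain rfl : i = j := by
    by_contra hij
    apply hg₀e
    rw [hev, Pi.single_eq_of_ne hij, zero_pow (by omega), mul_zero]
  have hc0 : c ≠ 0 := by
    intro hc; apply hg₀e; rw [hev, hc, zero_mul]
  set p : Fin (m + 1 + 2) → ℂ := Pi.single i 1 with hp_def
  have hpi : p i ≠ 0 := by rw [hp_def, Pi.single_eq_same]; exact one_ne_zero
  have hp0 : p ≠ 0 := fun h => hpi (by rw [h]; rfl)
  have hy₀ : (fun l => p (i.succAbove l) / p i) = 0 := by
    funext l; rw [hp_def, Pi.single_eq_of_ne (Fin.succAbove_ne i l)]; simp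
  -- nonsingular nearby members: the bifurcation clause at `a′ = 0`
  obtain ⟨hεa, hεb, -, hψ0, -, -, hns, -⟩ := id hB
  have hns₁ : ∀ c' : ℂ, c' ≠ 0 → ‖c'‖ < εb →
      SmoothHypersurface.IsNonsingularForm ℂ (f₁ + c' • (c • X i ^ d : MvPolynomial (Fin (m + 1 + 2)) ℂ)) := by
    intro c' hc'0 hc'
    have h := (hns 0 c' (by simpa using hεa) hc').2 ⟨hc'0, by rw [hψ0]; exact hc'0⟩
    rw [← hg₀eq]
    simpa using h
  -- H-A3NU for the direction `c·xᵢ^d = g₀`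
  obtain ⟨R₀, hR₀, hNU⟩ := circleTransport_not_unipotent_of_A3chart hd hf₁ hp0 hsing i hpi hc0 hεb hns₁ h2 h4 Θ
    (by rw [hy₀]; exact h0s) (by rw [hy₀]; exact hΘ0) hΘ hΘs hΘφ
  refine symmetricA3NonCommutation_mono_of_forall_circleTransport_not_unipotent (Nat.succ_pos m) hd hodd ⟨i, c, hg₀eq⟩ hf₁ hg₀
    hg₂ hD hB ⟨R₀, hR₀, fun R hR hRR₀ s₀ C hC hU T hT => hNU R hR hRR₀ s₀ C (fun θ => by rw [hC θ, hg₀eq]) hU T hT⟩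

/-- **hN′ — the registered stub `stub_a3NonCommOdd` of crux K1-B, verbatim and unconditionally**: for `n, d ≥ 1`, `n` odd,
`g₀ = c·xᵢ^d`, forms `f₁, g₀, g₂` of degree `d` with `IsSymmetricA3Datum f₁ g₀ g₂ j k a`, and every bifurcation datum
`(εa, εb, ψ)`, there is `0 < εa' ≤ εa` with `SymmetricA3NonCommutation n d f₁ g₀ g₂ ψ εa'` (the two local monodromies at the
symmetric `A₃` point do not commute). [cite: ArnoldGuseinzadeVarchenko2012, Part I §5.2, §2.3 and §2.9 Thm. 2.15]
[cite: Milnor1968, §9 Thm. 9.1 and Lemma 9.4] [cite: VoisinHodgeII2003, §3.2.1 Thm. 3.16] -/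
theorem symmetricA3NonCommutation_mono_holds :
    ∀ (n d : ℕ) (f₁ g₀ g₂ : MvPolynomial (Fin (n + 2)) ℂ) (j k : Fin (n + 2)) (a : Fin (n + 2) → ℂˣ),
      1 ≤ n → 1 ≤ d → Odd n → (∃ (i : Fin (n + 2)) (c : ℂ), g₀ = c • MvPolynomial.X i ^ d) →
      f₁.IsHomogeneous d → g₀.IsHomogeneous d → g₂.IsHomogeneous d → IsSymmetricA3Datum f₁ g₀ g₂ j k a →
      ∀ (εa εb : ℝ) (ψ : ℂ → ℂ), IsSymmetricA3Bifurcation f₁ g₀ g₂ j a εa εb ψ →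
        ∃ εa' : ℝ, 0 < εa' ∧ εa' ≤ εa ∧ SymmetricA3NonCommutation n d f₁ g₀ g₂ ψ εa' := by
  intro n d f₁ g₀ g₂ j k a hn hd hodd hg₀X hf₁ hg₀ hg₂ hD εa εb ψ hB
  obtain ⟨m, rfl⟩ : ∃ m, n = m + 1 := ⟨n - 1, by omega⟩
  obtain ⟨Θ, h0s, hΘ0, -, hΘ, hΘs, hΘφ⟩ := IsSymmetricA3Datum.exists_pencil_A3Chart hf₁ hg₀ hg₂ (Nat.succ_pos m) hD
  exact symmetricA3NonCommutation_of_A3chart (Nat.succ_pos m) hd hodd hg₀X hf₁ hg₀ hg₂ hD hB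
    (w := fun l : Fin (m + 1 + 1) => if l = Fin.last (m + 1) then 4 else 2)
    (fun l => if_neg (Fin.castSucc_lt_last l).ne) (if_pos rfl) Θ h0s hΘ0 hΘ hΘs hΘφ

end WeightedPencil

end Literature.AlgebraicGeometry.HodgeTheory

end
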